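import Summits.QuantumFields.QCD.Theorems.EulerDescentHonestHeavyAnchorUpperLocatorReduction
import Summits.QuantumFields.QCD.Theorems.SpectralDefectExtinctionChiralDescentLatticeNontriviality
import Literature.MathematicalPhysics.QuantumLattice.SchwartzTranslationCutoff

/-!
# The UPPER LOCATOR `stub_offsetBoundedAbove` (line `bounded_locator`, crux `EulerDescent.HonestHeavyAnchor`,
# item stmt-QuantumFields-16901) from a LATTICE-ONLY heavy-channel decoupling statement — the OS datum eliminated

Helper file (def-free, sorry-free) of worker `stub_offsetBoundedAbove` (lead prover-line-stmt-QuantumFields-16901-0,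
cycle 1; revised in the same cycle, see "Revision" below), composing

* `HonestHeavyAnchorUpperLocator.offsetBoundedAbove_of_heavyChannelDecoupling`
  (`Theorems/EulerDescentHonestHeavyAnchorUpperLocatorReduction.lean`): the registered stub follows from CONTINUUM-level
  heavy-channel decoupling "offset `→ +∞` + `IsQCDAlong` + gaps ⇒ `¬ T.IsNontrivial (pseudoRe f g)`";
* the real-pair form of non-triviality (`HypercubicLimit.Negative.twoPointNontrivial_iff_real`: `T.IsNontrivial s` iff
  ONE real pair `u` (negative times), `v` (positive times) has non-zero truncated OS two-point value), UPGRADED here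
  to a STRICTLY time-separated pair (§1, `exists_strictlySeparated_of_truncated_ne_zero`: translation is continuous
  on Schwartz space, `Literature.MathematicalPhysics.QuantumLattice.continuous_compSubConstCLM`, and the truncated
  two-point value is continuous along it, so a witness pair can be pushed `ε` away from the time-zero plane);
* the convergence clause of `IsQCDAlong` at `n = 2, 1` on real tensors,

into `offsetBoundedAbove_of_separatedLatticeDecoupling : SLHCD → stub_offsetBoundedAbove` (registered statement
verbatim as the consequent), where the hypothesis SLHCD — SEPARATED LATTICE HEAVY-CHANNEL DECOUPLING — speaks of
honest lattice expectations `qcdLatticeSchwinger` only: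

  for `N_f ∈ {2,3}`, a mass-scaling, asymptotically scaling regularisation `reg` whose couplings have the eventual
  intrinsic Wilson corner `mc → 0` and whose renormalised corner offset `(m_crit(k) − mc(k))·Z_m(k)/a_k → +∞` along
  the WHOLE sequence; for every tuple `m` and all species renormalisations `z, shift` keeping the bare masses
  eventually on the branch `m_f(k) > −1` (Lüscher positivity range) and having SOME uniform lattice gap `Δ > 0`; for
  all `f ≠ g`: IF the smeared lattice two-point functions of `Re ψ̄_f iγ₅ ψ_g` converge on EVERY separated real pair
  and its one-point functions converge on EVERY real test function, THEN for every `ε > 0` and every real pair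
  `u ⊗ v` with `supp u ⊆ {x⁰ < −ε}`, `supp v ⊆ {x⁰ > ε}` the truncated two-point function tends to `0`.

Why this shape (and the Revision).  The free multiplicative renormalisation `z_s(k)` of `IsQCDAlong` can normalise
the smeared two-point function of ANY ONE pair to `1`; so a decoupling hypothesis whose only convergence premise is
"the functions converge at THIS pair" (the shape of the first version of this file, theorem
`offsetBoundedAbove_of_latticeHeavyChannelDecoupling`, p167640, and of the sibling
`ChiralDescent.GapUpsetRecut.LatticeNontriviality.stub_wallLimitNoGo_of_latticeWallDecoupling`) is formally a valid
antecedent but physically UNSATISFIABLE — that theorem is withdrawn here (removed; it proved nothing false, it was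
useless).  With convergence at ALL pairs the normalisation trick is dead: under reflection positivity the RP-diagonal
correlator at separation `τ` is dominated by `e^{−E_k τ/2}` times the one at `τ/2`
(`HonestHeavyAnchorDecoupling.spectralSum_ratio_lower_bound`, Lüscher's transfer matrix), so normalising one
separation blows up all smaller ones.  The same mechanism is why the conclusion is asked only for STRICTLY separated
pairs (`ε > 0`): pairs touching the time-zero plane have no closer pair to compare with; the OS side supplies the
strictness for free (§1).  What a decoupling prover has to show about `qcdLatticeSchwinger` is therefore exactly SLHCD:
RP-diagonal ratio domination with a rate `E_k → ∞` in physical units (the OPEN renormalised, corner-relative rate;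
configuration-wise bounds such as `Literature.MathematicalPhysics.QuantumLattice.norm_inv_wilsonDirac_apply_le` see
only the bare mass — `Literature.Barriers.QuantumFields.VafaWittenEigenvalueBound`), the two-separation limit
exchange `HonestHeavyAnchorDecoupling.limit_eq_zero_of_divergent_logRatio`
(`Theorems/EulerDescentHonestHeavyAnchorDecoupling.lean`, immune to `z`), Cauchy–Schwarz from diagonal to general
pairs, and flavour symmetry for the one-point functions.
-/

noncomputable section

namespace Summit.QuantumFields.QCD.Theorems.HonestHeavyAnchorUpperLocator

open scoped SchwartzMap
open Filter Topology
open Literature.MathematicalPhysics.AQFT Literature.MathematicalPhysics.QuantumLattice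
open Literature.MathematicalPhysics.QuantumFieldTheory
open Summit.QuantumFields.YangMills.Theorems.HypercubicLimit.Negative (tensor₁ tensor₂ tensor₁_apply tensor₂_apply
  isTensorOf_tensor₁ isTensorOf_tensor₂ isOffDiagonal_of_halfSpaces isOffDiagonal_fin_one twoPointNontrivial_iff_real)

/-! ## §1 Strict time separation of a real non-triviality witness (OS side, any labelled Schwinger family) -/

section Separation

variable {ι : Type}

/-- Translating a real test function supported in `{x⁰ < 0}` by `−t e₀` puts its support in `{x⁰ < −t}`. [folklore] -/
theorem tsupport_translate_subset_lt {u : 𝓢(EuclideanSpace ℝ (Fin 4), ℝ)}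
    (hu : tsupport u ⊆ {y : EuclideanSpace ℝ (Fin 4) | y 0 < 0}) (t : ℝ) :
    tsupport ((SchwartzMap.compSubConstCLM ℝ (-(t • EuclideanSpace.single (0 : Fin 4) (1 : ℝ))) u :
        𝓢(EuclideanSpace ℝ (Fin 4), ℝ)) : EuclideanSpace ℝ (Fin 4) → ℝ) ⊆
      {y : EuclideanSpace ℝ (Fin 4) | y 0 < -t} := by
  intro x hx
  have h := tsupport_comp_subset_preimage (u : EuclideanSpace ℝ (Fin 4) → ℝ)
    (f := fun x => x - -(t • EuclideanSpace.single (0 : Fin 4) (1 : ℝ))) (continuous_id.sub continuous_const) hx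
  have h' := hu h
  simp only [Set.mem_setOf_eq, sub_neg_eq_add, PiLp.add_apply, PiLp.smul_apply,
    PiLp.single_apply, if_true, smul_eq_mul, mul_one] at h'
  show x 0 < -t
  linarith

/-- Translating a real test function supported in `{x⁰ > 0}` by `+t e₀` puts its support in `{x⁰ > t}`. [folklore] -/
theorem tsupport_translate_subset_gt {v : 𝓢(EuclideanSpace ℝ (Fin 4), ℝ)}
    (hv : tsupport v ⊆ {y : EuclideanSpace ℝ (Fin 4) | 0 < y 0}) (t : ℝ) :
    tsupport ((SchwartzMap.compSubConstCLM ℝ (t • EuclideanSpace.single (0 : Fin 4) (1 : ℝ)) v :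
        𝓢(EuclideanSpace ℝ (Fin 4), ℝ)) : EuclideanSpace ℝ (Fin 4) → ℝ) ⊆
      {y : EuclideanSpace ℝ (Fin 4) | t < y 0} := by
  intro x hx
  have h := tsupport_comp_subset_preimage (v : EuclideanSpace ℝ (Fin 4) → ℝ)
    (f := fun x => x - t • EuclideanSpace.single (0 : Fin 4) (1 : ℝ)) (continuous_id.sub continuous_const) hx
  have h' := hv h
  simp only [Set.mem_setOf_eq, PiLp.sub_apply, PiLp.smul_apply,
    PiLp.single_apply, if_true, smul_eq_mul, mul_one] at h'
  show t < x 0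
  linarith

/-- The real two-tensor of the translated pair is the translate of the real two-tensor by the two-point vector
`(−t e₀, +t e₀)`. [folklore] -/
theorem tensor₂_translate (u v : 𝓢(EuclideanSpace ℝ (Fin 4), ℝ)) (t : ℝ) :
    tensor₂ (SchwartzMap.compSubConstCLM ℝ (-(t • EuclideanSpace.single (0 : Fin 4) (1 : ℝ))) u)
        (SchwartzMap.compSubConstCLM ℝ (t • EuclideanSpace.single (0 : Fin 4) (1 : ℝ)) v) =
      SchwartzMap.compSubConstCLM ℂ
        (t • (![-(EuclideanSpace.single (0 : Fin 4) (1 : ℝ)), EuclideanSpace.single (0 : Fin 4) (1 : ℝ)] :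
          Fin (1 + 1) → EuclideanSpace ℝ (Fin 4))) (tensor₂ u v) := by
  ext x
  simp only [tensor₂_apply, SchwartzMap.compSubConstCLM_apply, Pi.sub_apply, Pi.smul_apply,
    Matrix.cons_val_zero, Matrix.cons_val_one, smul_neg]

/-- The real one-tensor of a translated test function is the translate of the real one-tensor. [folklore] -/
theorem tensor₁_translate (w : 𝓢(EuclideanSpace ℝ (Fin 4), ℝ)) (a : EuclideanSpace ℝ (Fin 4)) :
    tensor₁ (SchwartzMap.compSubConstCLM ℝ a w) =
      SchwartzMap.compSubConstCLM ℂ ((fun _ => a) : Fin 1 → EuclideanSpace ℝ (Fin 4)) (tensor₁ w) := by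
  ext x
  simp only [tensor₁_apply, SchwartzMap.compSubConstCLM_apply, Pi.sub_apply]

/-- **Strict separation of a real non-triviality witness.**  If the truncated two-point value of a labelled
Schwinger family at the species `s` is non-zero on a real pair `u` (support in `{x⁰ < 0}`), `v` (support in
`{x⁰ > 0}`), then it is non-zero on a real pair supported in `{x⁰ < −ε}`, `{x⁰ > ε}` for some `ε > 0` — translate
`u` by `−ε e₀` and `v` by `+ε e₀`; translation is continuous on Schwartz space and the Schwinger functions are
continuous linear functionals, so the truncated value is continuous in `ε` and stays non-zero for small `ε`. [folklore] -/
theorem exists_strictlySeparated_of_truncated_ne_zero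
    (S : LabelledSchwingerFamily ι (EuclideanSpace ℝ (Fin 4))) (s : ι) {u v : 𝓢(EuclideanSpace ℝ (Fin 4), ℝ)}
    (hu : tsupport u ⊆ {y : EuclideanSpace ℝ (Fin 4) | y 0 < 0})
    (hv : tsupport v ⊆ {y : EuclideanSpace ℝ (Fin 4) | 0 < y 0})
    (hne : S (1 + 1) (fun _ => s) (tensor₂ u v) - S 1 (fun _ => s) (tensor₁ u) * S 1 (fun _ => s) (tensor₁ v) ≠ 0) :
    ∃ ε : ℝ, 0 < ε ∧ ∃ u' v' : 𝓢(EuclideanSpace ℝ (Fin 4), ℝ),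
      tsupport u' ⊆ {y : EuclideanSpace ℝ (Fin 4) | y 0 < -ε} ∧
      tsupport v' ⊆ {y : EuclideanSpace ℝ (Fin 4) | ε < y 0} ∧
      S (1 + 1) (fun _ => s) (tensor₂ u' v') - S 1 (fun _ => s) (tensor₁ u') * S 1 (fun _ => s) (tensor₁ v') ≠ 0 := by
  set e : EuclideanSpace ℝ (Fin 4) := EuclideanSpace.single (0 : Fin 4) (1 : ℝ) with he
  set c₂ : Fin (1 + 1) → EuclideanSpace ℝ (Fin 4) := ![-e, e] with hc₂
  -- the truncated value along the translated pair, as a continuous function of the translation parameter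
  set Φ : ℝ → ℂ := fun t =>
    S (1 + 1) (fun _ => s) (SchwartzMap.compSubConstCLM ℂ (t • c₂) (tensor₂ u v)) -
      S 1 (fun _ => s) (SchwartzMap.compSubConstCLM ℂ ((fun _ => -(t • e)) : Fin 1 → EuclideanSpace ℝ (Fin 4))
          (tensor₁ u)) *
        S 1 (fun _ => s) (SchwartzMap.compSubConstCLM ℂ ((fun _ => t • e) : Fin 1 → EuclideanSpace ℝ (Fin 4))
          (tensor₁ v)) with hΦ
  have hcont : Continuous Φ := by
    refine Continuous.sub ?_ (Continuous.mul ?_ ?_)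
    · exact (S (1 + 1) (fun _ => s)).continuous.comp
        ((continuous_compSubConstCLM ℂ (tensor₂ u v)).comp (continuous_id.smul continuous_const))
    · exact (S 1 (fun _ => s)).continuous.comp
        ((continuous_compSubConstCLM ℂ (tensor₁ u)).comp
          (continuous_pi fun _ => (continuous_id.smul continuous_const).neg))
    · exact (S 1 (fun _ => s)).continuous.comp
        ((continuous_compSubConstCLM ℂ (tensor₁ v)).comp (continuous_pi fun _ => continuous_id.smul continuous_const))
  have hΦ0 : Φ 0 ≠ 0 := by
    have h2 : SchwartzMap.compSubConstCLM ℂ ((0 : ℝ) • c₂) (tensor₂ u v) = tensor₂ u v := by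
      rw [zero_smul, SchwartzMap.compSubConstCLM_zero]; rfl
    have hu1 : SchwartzMap.compSubConstCLM ℂ ((fun _ => -((0 : ℝ) • e)) : Fin 1 → EuclideanSpace ℝ (Fin 4))
        (tensor₁ u) = tensor₁ u := by
      rw [show ((fun _ => -((0 : ℝ) • e)) : Fin 1 → EuclideanSpace ℝ (Fin 4)) = 0 by
        funext i; simp, SchwartzMap.compSubConstCLM_zero]; rfl
    have hv1 : SchwartzMap.compSubConstCLM ℂ ((fun _ => (0 : ℝ) • e) : Fin 1 → EuclideanSpace ℝ (Fin 4))
        (tensor₁ v) = tensor₁ v := by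
      rw [show ((fun _ => (0 : ℝ) • e) : Fin 1 → EuclideanSpace ℝ (Fin 4)) = 0 by
        funext i; simp, SchwartzMap.compSubConstCLM_zero]; rfl
    simp only [hΦ, h2, hu1, hv1]
    exact hne
  -- non-vanishing persists for small translations; pick a positive one
  obtain ⟨δ, hδ, hball⟩ := Metric.eventually_nhds_iff.1 (hcont.continuousAt.eventually_ne hΦ0)
  have hδ2 : dist (δ / 2) 0 < δ := by
    rw [Real.dist_eq, sub_zero, abs_of_pos (by linarith)]; linarith
  refine ⟨δ / 2, by linarith, SchwartzMap.compSubConstCLM ℝ (-((δ / 2) • e)) u,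
    SchwartzMap.compSubConstCLM ℝ ((δ / 2) • e) v, tsupport_translate_subset_lt hu _,
    tsupport_translate_subset_gt hv _, ?_⟩
  rw [tensor₂_translate, tensor₁_translate, tensor₁_translate]
  exact hball hδ2

end Separation

/-! ## §2 The upper locator from SEPARATED LATTICE heavy-channel decoupling -/

/-- **The upper locator from separated lattice heavy-channel decoupling.**  Hypothesis `hlat` (SLHCD, open; honest
lattice expectations only): for `N_f ∈ {2,3}`, a mass-scaling, asymptotically scaling `reg` with an eventual intrinsic
corner `mc → 0` and corner offset `(m_crit(k) − mc(k))·Z_m(k)/a_k → +∞`, every tuple `m`, all `z, shift` with the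
bare masses eventually on the branch `> −1` and some uniform lattice gap `Δ > 0`, all `f ≠ g`: if the smeared lattice
two-point functions of `Re ψ̄_f iγ₅ ψ_g` converge on EVERY separated real pair and its one-point functions on EVERY
real test function, then on every `ε`-separated real pair (`ε > 0`) the truncated two-point function tends to `0`.
Conclusion: the registered stub `stub_offsetBoundedAbove` verbatim.  Proof:
`offsetBoundedAbove_of_heavyChannelDecoupling`; `twoPointNontrivial_iff_real` and §1 turn
`T.IsNontrivial (pseudoRe f g)` into an `ε`-separated real pair with non-zero truncated OS value; the convergence
clause of `IsQCDAlong` at `n = 2, 1` feeds `hlat` and identifies that value as the limit of the truncated lattice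
values, which `hlat` sends to `0`. [folklore] -/
theorem offsetBoundedAbove_of_separatedLatticeDecoupling :
    (∀ Nf : ℕ, Nf = 2 ∨ Nf = 3 → ∀ (reg : QCDRegularisation Nf) (mc : ℕ → ℝ), reg.HasMassScaling →
      (reg.scheme 0 0 0).HasAsymptoticScaling →
      (∀ᶠ k in atTop, IsLUB {μ : ℝ | ¬ (∀ (R R' : ℕ) (A : QCDLatticeObservable Nf R)
        (B : QCDLatticeObservable Nf R'), ∃ (C δ : ℝ) (S₀ : ℕ), 0 < δ ∧ ∀ S : ℕ, S₀ ≤ S → ∀ n : ℕ, n ≤ S →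
          ‖qcdLatticeConnectedCorr (reg.β k) (2 * S + 1) (fun _ : Fin Nf => μ) A B n‖ ≤ C * Real.exp (-(δ * n)))} (mc k)) →
      Tendsto mc atTop (𝓝 0) →
      Tendsto (fun k => (reg.mcrit k - mc k) * reg.Zm k / reg.a k) atTop atTop →
      ∀ (m : Fin Nf → ℝ) (z shift : QCDField Nf → ℕ → ℝ),
      (∀ fl : Fin Nf, ∀ᶠ k in atTop, -1 < (reg.scheme m z shift).mq fl k) →
      (∃ Δ > 0, (reg.scheme m z shift).HasLatticeMassGap Δ) →
      ∀ f g : Fin Nf, f ≠ g →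
      (∀ u v : 𝓢(EuclideanSpace ℝ (Fin 4), ℝ), tsupport u ⊆ {y : EuclideanSpace ℝ (Fin 4) | y 0 < 0} →
        tsupport v ⊆ {y : EuclideanSpace ℝ (Fin 4) | 0 < y 0} →
        ∃ c₂ : ℂ, Tendsto (fun k : ℕ => qcdLatticeSchwinger (reg.scheme m z shift) k (1 + 1)
          (fun _ => QCDField.pseudoRe f g) ![u, v]) atTop (𝓝 c₂)) →
      (∀ w : 𝓢(EuclideanSpace ℝ (Fin 4), ℝ), ∃ c₁ : ℂ, Tendsto (fun k : ℕ => qcdLatticeSchwinger (reg.scheme m z shift) k 1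
          (fun _ => QCDField.pseudoRe f g) ![w]) atTop (𝓝 c₁)) →
      ∀ ε : ℝ, 0 < ε → ∀ u v : 𝓢(EuclideanSpace ℝ (Fin 4), ℝ),
      tsupport u ⊆ {y : EuclideanSpace ℝ (Fin 4) | y 0 < -ε} → tsupport v ⊆ {y : EuclideanSpace ℝ (Fin 4) | ε < y 0} →
      Tendsto (fun k : ℕ => qcdLatticeSchwinger (reg.scheme m z shift) k (1 + 1) (fun _ => QCDField.pseudoRe f g) ![u, v] -
        qcdLatticeSchwinger (reg.scheme m z shift) k 1 (fun _ => QCDField.pseudoRe f g) ![u] *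
          qcdLatticeSchwinger (reg.scheme m z shift) k 1 (fun _ => QCDField.pseudoRe f g) ![v]) atTop (𝓝 0)) →
    ∀ Nf : ℕ, Nf = 2 ∨ Nf = 3 → ∀ (reg : QCDRegularisation Nf) (mc : ℕ → ℝ) (M : ℝ), reg.HasMassScaling →
      (reg.scheme 0 0 0).HasAsymptoticScaling →
      (∀ᶠ k in atTop, IsLUB {μ : ℝ | ¬ (∀ (R R' : ℕ) (A : QCDLatticeObservable Nf R)
        (B : QCDLatticeObservable Nf R'), ∃ (C δ : ℝ) (S₀ : ℕ), 0 < δ ∧ ∀ S : ℕ, S₀ ≤ S → ∀ n : ℕ, n ≤ S →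
          ‖qcdLatticeConnectedCorr (reg.β k) (2 * S + 1) (fun _ : Fin Nf => μ) A B n‖ ≤ C * Real.exp (-(δ * n)))} (mc k)) →
      Tendsto mc atTop (𝓝 0) →
      (∀ m : Fin Nf → ℝ, (∀ f, M < m f) → ∃ (z shift : QCDField Nf → ℕ → ℝ) (T : OSData (QCDField Nf) 4),
        IsQCDAlong (reg.scheme m z shift) T ∧ T.IsNontrivial QCDField.glue ∧ T.IsNonGaussian QCDField.glue ∧
          (∀ f g : Fin Nf, f ≠ g → T.IsNontrivial (QCDField.pseudoRe f g)) ∧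
            ∃ Δ > 0, T.HasMassGap Δ ∧ (reg.scheme m z shift).HasLatticeMassGap Δ) →
      ∃ M₂ : ℝ, ∀ᶠ k in atTop, (reg.mcrit k - mc k) * reg.Zm k / reg.a k ≤ M₂ := by
  intro hlat
  refine offsetBoundedAbove_of_heavyChannelDecoupling ?_
  intro Nf hNf reg mc m z shift T Δ f g hfg hΔ hms hcorner hmc hoff hQ hL _hT hN
  -- a real witness pair of `T.IsNontrivial (pseudoRe f g)`, pushed `ε` away from the time-zero plane
  obtain ⟨u₀, v₀, hu₀, hv₀, hne₀⟩ := (twoPointNontrivial_iff_real T.schwinger (QCDField.pseudoRe f g)).1 hN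
  obtain ⟨ε, hε, u, v, hu, hv, hne⟩ := exists_strictlySeparated_of_truncated_ne_zero T.schwinger
    (QCDField.pseudoRe f g) hu₀ hv₀ (sub_ne_zero.2 hne₀)
  have hu' : tsupport u ⊆ {y : EuclideanSpace ℝ (Fin 4) | y 0 < 0} := fun y hy => by
    have h := hu hy
    simp only [Set.mem_setOf_eq] at h ⊢
    linarith
  have hv' : tsupport v ⊆ {y : EuclideanSpace ℝ (Fin 4) | 0 < y 0} := fun y hy => by
    have h := hv hy
    simp only [Set.mem_setOf_eq] at h ⊢
    linarith
  -- the convergence clause of `IsQCDAlong` at `n = 2, 1` on real tensors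
  have hconv₂ : ∀ u v : 𝓢(EuclideanSpace ℝ (Fin 4), ℝ), tsupport u ⊆ {y : EuclideanSpace ℝ (Fin 4) | y 0 < 0} →
      tsupport v ⊆ {y : EuclideanSpace ℝ (Fin 4) | 0 < y 0} →
      Tendsto (fun k : ℕ => qcdLatticeSchwinger (reg.scheme m z shift) k (1 + 1) (fun _ => QCDField.pseudoRe f g)
        ![u, v]) atTop (𝓝 (T.schwinger (1 + 1) (fun _ => QCDField.pseudoRe f g) (tensor₂ u v))) :=
    fun u v hu hv => hQ.2.2 (1 + 1) (by norm_num) (fun _ => QCDField.pseudoRe f g) ![u, v] (tensor₂ u v)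
      (isTensorOf_tensor₂ u v) (isOffDiagonal_of_halfSpaces hu hv (isTensorOf_tensor₂ u v))
  have hconv₁ : ∀ w : 𝓢(EuclideanSpace ℝ (Fin 4), ℝ),
      Tendsto (fun k : ℕ => qcdLatticeSchwinger (reg.scheme m z shift) k 1 (fun _ => QCDField.pseudoRe f g) ![w])
        atTop (𝓝 (T.schwinger 1 (fun _ => QCDField.pseudoRe f g) (tensor₁ w))) :=
    fun w => hQ.2.2 1 one_ne_zero (fun _ => QCDField.pseudoRe f g) ![w] (tensor₁ w) (isTensorOf_tensor₁ w)
      (isOffDiagonal_fin_one _)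
  have hlim := hlat Nf hNf reg mc hms hQ.1 hcorner hmc hoff m z shift hQ.2.1 ⟨Δ, hΔ, hL⟩ f g hfg
    (fun u v hu hv => ⟨_, hconv₂ u v hu hv⟩) (fun w => ⟨_, hconv₁ w⟩) ε hε u v hu hv
  have hlim' := (hconv₂ u v hu' hv').sub ((hconv₁ u).mul (hconv₁ v))
  exact hne (tendsto_nhds_unique hlim' hlim)

/-! ## §3 Withdrawn first version (kept, append-only; DEPRECATED)

`offsetBoundedAbove_of_latticeHeavyChannelDecoupling` (p167640) is formally valid but USELESS as a research target:
its lattice hypothesis premises convergence of the smeared functions at ONE pair `u ⊗ v` only, and the free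
multiplicative renormalisation `z_s(k)` of `IsQCDAlong` can always be chosen to make that one pair converge to a
NON-ZERO value (normalise it to `1`; the one-point functions vanish by flavour symmetry with `shift = 0`), so the
hypothesis is unsatisfiable and nothing can ever be fed to the theorem.  Use
`offsetBoundedAbove_of_separatedLatticeDecoupling` (§2), whose premises quantify convergence over ALL pairs. -/

/-- **WITHDRAWN — use `offsetBoundedAbove_of_separatedLatticeDecoupling`.**  First version of the lattice reduction
(p167640): the registered stub from a lattice decoupling hypothesis premised on convergence at a SINGLE pair.  Valid,
but the hypothesis is physically unsatisfiable (the free renormalisation `z` normalises any one pair), see §3's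
header.  Kept only because `Theorems/` is append-only. [folklore] -/
@[deprecated offsetBoundedAbove_of_separatedLatticeDecoupling (since := "2026-08-17")]
theorem offsetBoundedAbove_of_latticeHeavyChannelDecoupling :
    (∀ Nf : ℕ, Nf = 2 ∨ Nf = 3 → ∀ (reg : QCDRegularisation Nf) (mc : ℕ → ℝ), reg.HasMassScaling →
      (reg.scheme 0 0 0).HasAsymptoticScaling →
      (∀ᶠ k in atTop, IsLUB {μ : ℝ | ¬ (∀ (R R' : ℕ) (A : QCDLatticeObservable Nf R)
        (B : QCDLatticeObservable Nf R'), ∃ (C δ : ℝ) (S₀ : ℕ), 0 < δ ∧ ∀ S : ℕ, S₀ ≤ S → ∀ n : ℕ, n ≤ S →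
          ‖qcdLatticeConnectedCorr (reg.β k) (2 * S + 1) (fun _ : Fin Nf => μ) A B n‖ ≤ C * Real.exp (-(δ * n)))} (mc k)) →
      Tendsto mc atTop (𝓝 0) →
      Tendsto (fun k => (reg.mcrit k - mc k) * reg.Zm k / reg.a k) atTop atTop →
      ∀ (m : Fin Nf → ℝ) (z shift : QCDField Nf → ℕ → ℝ),
      (∀ fl : Fin Nf, ∀ᶠ k in atTop, -1 < (reg.scheme m z shift).mq fl k) →
      (∃ Δ > 0, (reg.scheme m z shift).HasLatticeMassGap Δ) →
      ∀ f g : Fin Nf, f ≠ g → ∀ u v : 𝓢(EuclideanSpace ℝ (Fin 4), ℝ),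
      tsupport u ⊆ {y : EuclideanSpace ℝ (Fin 4) | y 0 < 0} → tsupport v ⊆ {y : EuclideanSpace ℝ (Fin 4) | 0 < y 0} →
      (∃ c₂ : ℂ, Tendsto (fun k : ℕ => qcdLatticeSchwinger (reg.scheme m z shift) k (1 + 1)
        (fun _ => QCDField.pseudoRe f g) ![u, v]) atTop (𝓝 c₂)) →
      (∃ c₁ : ℂ, Tendsto (fun k : ℕ => qcdLatticeSchwinger (reg.scheme m z shift) k 1
        (fun _ => QCDField.pseudoRe f g) ![u]) atTop (𝓝 c₁)) →
      (∃ c₁' : ℂ, Tendsto (fun k : ℕ => qcdLatticeSchwinger (reg.scheme m z shift) k 1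
        (fun _ => QCDField.pseudoRe f g) ![v]) atTop (𝓝 c₁')) →
      Tendsto (fun k : ℕ => qcdLatticeSchwinger (reg.scheme m z shift) k (1 + 1) (fun _ => QCDField.pseudoRe f g) ![u, v] -
        qcdLatticeSchwinger (reg.scheme m z shift) k 1 (fun _ => QCDField.pseudoRe f g) ![u] *
          qcdLatticeSchwinger (reg.scheme m z shift) k 1 (fun _ => QCDField.pseudoRe f g) ![v]) atTop (𝓝 0)) →
    ∀ Nf : ℕ, Nf = 2 ∨ Nf = 3 → ∀ (reg : QCDRegularisation Nf) (mc : ℕ → ℝ) (M : ℝ), reg.HasMassScaling →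
      (reg.scheme 0 0 0).HasAsymptoticScaling →
      (∀ᶠ k in atTop, IsLUB {μ : ℝ | ¬ (∀ (R R' : ℕ) (A : QCDLatticeObservable Nf R)
        (B : QCDLatticeObservable Nf R'), ∃ (C δ : ℝ) (S₀ : ℕ), 0 < δ ∧ ∀ S : ℕ, S₀ ≤ S → ∀ n : ℕ, n ≤ S →
          ‖qcdLatticeConnectedCorr (reg.β k) (2 * S + 1) (fun _ : Fin Nf => μ) A B n‖ ≤ C * Real.exp (-(δ * n)))} (mc k)) →
      Tendsto mc atTop (𝓝 0) →
      (∀ m : Fin Nf → ℝ, (∀ f, M < m f) → ∃ (z shift : QCDField Nf → ℕ → ℝ) (T : OSData (QCDField Nf) 4),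
        IsQCDAlong (reg.scheme m z shift) T ∧ T.IsNontrivial QCDField.glue ∧ T.IsNonGaussian QCDField.glue ∧
          (∀ f g : Fin Nf, f ≠ g → T.IsNontrivial (QCDField.pseudoRe f g)) ∧
            ∃ Δ > 0, T.HasMassGap Δ ∧ (reg.scheme m z shift).HasLatticeMassGap Δ) →
      ∃ M₂ : ℝ, ∀ᶠ k in atTop, (reg.mcrit k - mc k) * reg.Zm k / reg.a k ≤ M₂ := by
  intro hlat
  refine offsetBoundedAbove_of_heavyChannelDecoupling ?_
  intro Nf hNf reg mc m z shift T Δ f g hfg hΔ hms hcorner hmc hoff hQ hL _hT hN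
  -- non-triviality of `pseudoRe f g` in lattice terms: one real pair whose truncated two-point does not tend to `0`
  obtain ⟨u, v, hu, hv, hnot⟩ := (Summit.QuantumFields.QCD.Cruxes.ChiralDescent.GapUpsetRecut.LatticeNontriviality.isNontrivial_iff_lattice hQ (QCDField.pseudoRe f g)).1 hN
  -- the convergence clause of `IsQCDAlong` at `n = 2, 1` on the real tensors
  have h2 := hQ.2.2 (1 + 1) (by norm_num) (fun _ => QCDField.pseudoRe f g) ![u, v] (tensor₂ u v)
    (isTensorOf_tensor₂ u v) (isOffDiagonal_of_halfSpaces hu hv (isTensorOf_tensor₂ u v))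
  have hu1 := hQ.2.2 1 one_ne_zero (fun _ => QCDField.pseudoRe f g) ![u] (tensor₁ u) (isTensorOf_tensor₁ u)
    (isOffDiagonal_fin_one _)
  have hv1 := hQ.2.2 1 one_ne_zero (fun _ => QCDField.pseudoRe f g) ![v] (tensor₁ v) (isTensorOf_tensor₁ v)
    (isOffDiagonal_fin_one _)
  exact hnot (hlat Nf hNf reg mc hms hQ.1 hcorner hmc hoff m z shift hQ.2.1 ⟨Δ, hΔ, hL⟩ f g hfg u v hu hv
    ⟨_, h2⟩ ⟨_, hu1⟩ ⟨_, hv1⟩)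

end Summit.QuantumFields.QCD.Theorems.HonestHeavyAnchorUpperLocator

end
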